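import Summits.SmoothPoincare4.SmoothPoincare4.Theorems.CongruenceShadowsNormalFormStablyTrivialLuftStubFreePaddingAux
import Literature.GroupTheory.CombinatorialGroupTheory.FreeGroupRebasing

/-!
# Stub `stub_freePadding` of line `luft-twist-reduction` for crux `NormalFormStablyTrivial`
# (item stmt-SmoothPoincare4-14591, route `CongruenceShadows`) — the stable padding lemma

Proves the registered stub **`stub_freePadding : FreePadding`** verbatim (`FreePadding`,
`…LuftDefs.lean` §4; TRIAGE-r1-2 App. A of the crux), a theorem about free groups only.

Coordinates.  Level `m`: `g = 3 + 3m`, `F = F_g` with blocks `e_j = x_{3j}` (essential),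
`y_j = x_{3j+1}`, `z_j = x_{3j+2}` (trivial); `P₀ = ⟪y, z⟫`, `P₂ = ⟪e, y⟫`, `Q = θ(P₂)` with
`P₀ ⊔ Q = ⊤`.  Big level `m + (m+1)`: `N = 3 + 3(m+(m+1)) = 2g`, `F' = F_N`, `ι : F →* F'` the level
inclusion (old letters keep their index), new blocks `e'_j = x_{g+3j}`, `y'_j = x_{g+3j+1}`,
`z'_j = x_{g+3j+2}`; `P₂' = ⟪e, y, e', y'⟫`, `Q' = ⟪ι Q ∪ {e', y'}⟫`.  GOAL: `v(P₂') = Q'` for some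
`v` in `E = closure (paddingGens N)`.

Proof.  Let `π : F' →* F(z, z')` kill `e, y, e', y'` (`ker π = P₂'`, `ker_lift_dite`) and let
`q : F' →* F(z, z')` be `π ∘ Θ'⁻¹`, where `Θ'` is `θ` on the old letters and the identity on the
new ones: `q(old xᵢ) = π ι θ⁻¹(xᵢ)`, `q(new xᵢ) = π(xᵢ)`; then `ker q = Q'` (§ kernel of `q`,
via the homomorphism `ψ : F(z,z') → F'/Q'`, `ψ ∘ q = mk`).  Transversality `P₀ ⊔ θ P₂ = ⊤` gives,
for every old letter `x_t`, a word `h_t ∈ P₀` with `π ι θ⁻¹ h_t = π ι x_t`.  MOVES (all in `E` by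
the move algebra of `…LuftStubFreePaddingAux.lean`): (1) `v₁ : y'_j ↦ y'_j · ι h_{z_j}`
(`h ∈ P₀ = ⟪trivial old letters⟫`, `y'_j` trivial: `exists_transvection_of_mem_normalClosure`),
after which `q v₁ (y'_j) = π(z_j)` and `q ∘ v₁ ∘ λ = π ∘ ι` for the substitution `λ : z_j ↦ y'_j`,
`e_j, y_j ↦ 1`; (2) `v₂ : x_s ↦ x_s · λ((θ⁻¹x_s)⁻¹ x_s)` for every old letter `x_s` (transvections
by the trivial letters `y'`), after which `q v₁ v₂ (x_s) = π(x_s)` for all old `s`;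
(3) `v₃ : y'_j ↦ y'_j z_j⁻¹`, after which `q v₁ v₂ v₃ (y'_j) = π(z_j) π(z_j)⁻¹ = 1`.  Hence
`q ∘ v = π` for `v = v₁ v₂ v₃` (checked letter by letter), so
`v⁻¹(Q') = ker (q ∘ v) = ker π = P₂'`, i.e. `v(P₂') = Q'`.  ∎

References: Luft, Math. Ann. 234 (1978); McCool, J. Algebra 35 (1975) (partial conjugations);
Nielsen, Math. Ann. 91 (1924); Lyndon–Schupp, *Combinatorial Group Theory* (1977), Ch. I §4.
-/

-- the prescribed namespace `Summit.<P>.<Sub>.…` duplicates `SmoothPoincare4` (P = Sub)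
set_option linter.dupNamespace false

noncomputable section

namespace Summit.SmoothPoincare4.SmoothPoincare4.Theorems.NormalFormStablyTrivial.Luft

open Literature.GroupTheory.CombinatorialGroupTheory

/-- A homomorphism out of a free group takes values in any subgroup containing the images of the
letters. -/
theorem freeGroup_hom_apply_mem {α G : Type*} [Group G] (f : FreeGroup α →* G) {K : Subgroup G}
    (hK : ∀ a, f (FreeGroup.of a) ∈ K) (w : FreeGroup α) : f w ∈ K := by
  have hr : f.range ≤ K := by
    rw [MonoidHom.range_eq_map, ← FreeGroup.closure_range_of, MonoidHom.map_closure,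
      Subgroup.closure_le]
    rintro _ ⟨_, ⟨a, rfl⟩, rfl⟩
    exact hK a
  exact hr ⟨w, rfl⟩

/-- **The stable padding lemma** (registered stub `stub_freePadding`, statement `FreePadding` of
`…LuftDefs.lean` §4; TRIAGE-r1-2 App. A): for every automorphism `θ` of `F_{3+3m}` with
`P₀ ⊔ θ(P₂) = ⊤`, after `m + 1` block stabilisations the stabilised shadow
`Q' = ⟪ι θ(P₂) ∪ new standard generators⟫` is the image of the standard shadow `P₂'` under a
product of padding moves (right transvections by trivial letters, partial conjugations of trivial
letters).  See the module docstring for the proof. -/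
theorem stub_freePadding : FreePadding := by
  intro m θ hyp
  /- index maps: `r` retracts big letters to old ones (`r ∘ castLE = id`), `y t = g + t - 1`
  (`z_j ↦ y'_j`), `z i = i - g + 1` (`y'_j ↦ z_j`) -/
  obtain ⟨r, hr, hro⟩ : ∃ r : Fin (3 + 3 * (m + (m + 1))) → Fin (3 + 3 * m),
      (∀ i : Fin (3 + 3 * (m + (m + 1))), (i : ℕ) < 3 + 3 * m → ((r i : Fin (3 + 3 * m)) : ℕ) = i) ∧
      ∀ t, r (Fin.castLE (level_le m (m + 1)) t) = t :=
    ⟨fun i => ⟨(i : ℕ) % (3 + 3 * m), Nat.mod_lt _ (by omega)⟩, fun i hi => Nat.mod_eq_of_lt hi,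
      fun t => Fin.ext (Nat.mod_eq_of_lt t.2)⟩
  have hor : ∀ i : Fin (3 + 3 * (m + (m + 1))), (i : ℕ) < 3 + 3 * m →
      Fin.castLE (level_le m (m + 1)) (r i) = i := fun i hi => Fin.ext (hr i hi)
  obtain ⟨y, hy⟩ : ∃ y : Fin (3 + 3 * m) → Fin (3 + 3 * (m + (m + 1))),
      ∀ t, (y t : ℕ) = 3 + 3 * m + t - 1 :=
    ⟨fun t => ⟨3 + 3 * m + t - 1, by have := t.isLt; omega⟩, fun t => rfl⟩
  obtain ⟨z, hz⟩ : ∃ z : Fin (3 + 3 * (m + (m + 1))) → Fin (3 + 3 * (m + (m + 1))),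
      ∀ i, (z i : ℕ) = (i : ℕ) - (3 + 3 * m) + 1 :=
    ⟨fun i => ⟨(i : ℕ) - (3 + 3 * m) + 1, by have := i.isLt; omega⟩, fun i => rfl⟩
  -- the letters moved: `LY` = the new `y'`-letters, `LO` = the old letters
  obtain ⟨LY, hLY⟩ : ∃ LY : Finset (Fin (3 + 3 * (m + (m + 1)))),
      ∀ i, i ∈ LY ↔ 3 + 3 * m ≤ (i : ℕ) ∧ (i : ℕ) % 3 = 1 :=
    ⟨Finset.univ.filter fun i => 3 + 3 * m ≤ (i : ℕ) ∧ (i : ℕ) % 3 = 1, fun i => by simp⟩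
  obtain ⟨LO, hLO⟩ : ∃ LO : Finset (Fin (3 + 3 * (m + (m + 1)))),
      ∀ i, i ∈ LO ↔ (i : ℕ) < 3 + 3 * m :=
    ⟨Finset.univ.filter fun i => (i : ℕ) < 3 + 3 * m, fun i => by simp⟩
  /- `π : F' → F(z, z')` kills `e, y, e', y'`; `ker π = P₂'` -/
  obtain ⟨π, hπ2, hπn, hπker⟩ : ∃ π : FreeGroup (Fin (3 + 3 * (m + (m + 1)))) →*
      FreeGroup {i : Fin (3 + 3 * (m + (m + 1))) // (i : ℕ) % 3 = 2},
      (∀ (i : Fin (3 + 3 * (m + (m + 1)))) (hi : (i : ℕ) % 3 = 2),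
        π (FreeGroup.of i) = FreeGroup.of ⟨i, hi⟩) ∧
      (∀ i : Fin (3 + 3 * (m + (m + 1))), (i : ℕ) % 3 ≠ 2 → π (FreeGroup.of i) = 1) ∧
      π.ker = P2 (3 + 3 * (m + (m + 1))) :=
    ⟨FreeGroup.lift fun i => if hi : (i : ℕ) % 3 = 2 then FreeGroup.of ⟨i, hi⟩ else 1,
      fun i hi => by rw [FreeGroup.lift_apply_of, dif_pos hi],
      fun i hi => by rw [FreeGroup.lift_apply_of, dif_neg hi],
      ker_lift_dite fun i : Fin (3 + 3 * (m + (m + 1))) => (i : ℕ) % 3 = 2⟩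
  -- `π ∘ ι` kills `P₂`
  have hπι : ∀ b ∈ P2 (3 + 3 * m), π (levelIncl m (m + 1) b) = 1 := by
    intro b hb
    have hle : P2 (3 + 3 * m) ≤ (π.comp (levelIncl m (m + 1))).ker := by
      refine Subgroup.normalClosure_le_normal ?_
      rintro _ ⟨t, ht, rfl⟩
      rw [SetLike.mem_coe, MonoidHom.mem_ker, MonoidHom.comp_apply, levelIncl_of]
      exact hπn _ ht
    exact hle hb
  /- `q = π ∘ Θ'⁻¹`: old letters through `θ⁻¹`, new letters as they are -/
  obtain ⟨q, hqo, hqn⟩ : ∃ q : FreeGroup (Fin (3 + 3 * (m + (m + 1)))) →*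
      FreeGroup {i : Fin (3 + 3 * (m + (m + 1))) // (i : ℕ) % 3 = 2},
      (∀ i : Fin (3 + 3 * (m + (m + 1))), (i : ℕ) < 3 + 3 * m →
        q (FreeGroup.of i) = π (levelIncl m (m + 1) (θ⁻¹ (FreeGroup.of (r i))))) ∧
      (∀ i : Fin (3 + 3 * (m + (m + 1))), ¬ (i : ℕ) < 3 + 3 * m →
        q (FreeGroup.of i) = π (FreeGroup.of i)) :=
    ⟨FreeGroup.lift fun i => if (i : ℕ) < 3 + 3 * m
        then π (levelIncl m (m + 1) (θ⁻¹ (FreeGroup.of (r i)))) else π (FreeGroup.of i),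
      fun i hi => by rw [FreeGroup.lift_apply_of, if_pos hi],
      fun i hi => by rw [FreeGroup.lift_apply_of, if_neg hi]⟩
  have hqι : ∀ w, q (levelIncl m (m + 1) w) = π (levelIncl m (m + 1) (θ⁻¹ w)) := by
    intro w
    have : q.comp (levelIncl m (m + 1)) =
        (π.comp (levelIncl m (m + 1))).comp θ⁻¹.toMonoidHom :=
      FreeGroup.ext_hom _ _ fun t => by
        simp only [MonoidHom.comp_apply, MulEquiv.coe_toMonoidHom, levelIncl_of]
        rw [hqo (Fin.castLE (level_le m (m + 1)) t) t.2, hro]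
    exact DFunLike.congr_fun this w
  /- transversality: old words `h t ∈ P₀` with `π ι θ⁻¹ (h t) = π ι x_t` -/
  have hh : ∀ t : Fin (3 + 3 * m), ∃ h ∈ P0 (3 + 3 * m),
      π (levelIncl m (m + 1) (θ⁻¹ h)) = π (levelIncl m (m + 1) (FreeGroup.of t)) := by
    intro t
    have htop : θ (FreeGroup.of t) ∈ P0 (3 + 3 * m) ⊔ (P2 (3 + 3 * m)).map θ.toMonoidHom := by
      rw [hyp]; exact Subgroup.mem_top _
    obtain ⟨a, ha, b, hb, hab⟩ := Subgroup.mem_sup_of_normal_left.1 htop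
    obtain ⟨b₀, hb₀, rfl⟩ := Subgroup.mem_map.1 hb
    refine ⟨a, ha, ?_⟩
    have ha' : a = θ (FreeGroup.of t * b₀⁻¹) := by
      rw [map_mul, map_inv, eq_mul_inv_iff_mul_eq]
      exact hab
    rw [ha', MulAut.inv_apply_self, map_mul, map_inv, map_mul, map_inv, hπι b₀ hb₀, inv_one,
      mul_one]
  choose h hhP hhπ using hh
  /- the substitution `λ : z_t ↦ y'_t`, `e, y ↦ 1` and the words of step (2) -/
  obtain ⟨lam, hlam2, hlamn⟩ : ∃ lam : FreeGroup (Fin (3 + 3 * m)) →*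
      FreeGroup (Fin (3 + 3 * (m + (m + 1)))),
      (∀ t : Fin (3 + 3 * m), (t : ℕ) % 3 = 2 → lam (FreeGroup.of t) = FreeGroup.of (y t)) ∧
      (∀ t : Fin (3 + 3 * m), (t : ℕ) % 3 ≠ 2 → lam (FreeGroup.of t) = 1) :=
    ⟨FreeGroup.lift fun t => if (t : ℕ) % 3 = 2 then FreeGroup.of (y t) else 1,
      fun t ht => by rw [FreeGroup.lift_apply_of, if_pos ht],
      fun t ht => by rw [FreeGroup.lift_apply_of, if_neg ht]⟩
  have hlam_mem : ∀ w, lam w ∈ Subgroup.closure (FreeGroup.of ''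
      ({i | 3 + 3 * m ≤ (i : ℕ) ∧ (i : ℕ) % 3 = 1} : Set (Fin (3 + 3 * (m + (m + 1)))))) := by
    refine freeGroup_hom_apply_mem lam fun t => ?_
    by_cases ht : (t : ℕ) % 3 = 2
    · rw [hlam2 t ht]
      refine Subgroup.subset_closure ⟨y t, ?_, rfl⟩
      have := hy t
      have := t.isLt
      simp only [Set.mem_setOf_eq]
      omega
    · rw [hlamn t ht]
      exact one_mem _
  obtain ⟨u₂, hu₂⟩ : ∃ u₂ : Fin (3 + 3 * (m + (m + 1))) → FreeGroup (Fin (3 + 3 * (m + (m + 1)))),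
      ∀ i, u₂ i = lam ((θ⁻¹ (FreeGroup.of (r i)))⁻¹ * FreeGroup.of (r i)) :=
    ⟨_, fun i => rfl⟩
  /- side conditions of the three sweeps -/
  have hCO : ∀ i ∈ ({i | (i : ℕ) < 3 + 3 * m} : Set (Fin (3 + 3 * (m + (m + 1))))), i ∉ LY := by
    intro i hi hiL
    rw [hLY] at hiL
    simp only [Set.mem_setOf_eq] at hi
    omega
  have hCY : ∀ i ∈ ({i | 3 + 3 * m ≤ (i : ℕ) ∧ (i : ℕ) % 3 = 1} :
      Set (Fin (3 + 3 * (m + (m + 1))))), i ∉ LO := by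
    intro i hi hiL
    rw [hLO] at hiL
    simp only [Set.mem_setOf_eq] at hi
    omega
  have hι_mem : ∀ w, levelIncl m (m + 1) w ∈ Subgroup.closure (FreeGroup.of ''
      ({i | (i : ℕ) < 3 + 3 * m} : Set (Fin (3 + 3 * (m + (m + 1)))))) := by
    refine freeGroup_hom_apply_mem _ fun t => ?_
    rw [levelIncl_of]
    exact Subgroup.subset_closure ⟨_, t.2, rfl⟩
  have hι_avoid : ∀ s : Fin (3 + 3 * (m + (m + 1))), 3 + 3 * m ≤ (s : ℕ) →
      ∀ w, levelIncl m (m + 1) w ∈ Subgroup.closure (FreeGroup.of '' {i | i ≠ s}) := by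
    intro s hs
    refine freeGroup_hom_apply_mem _ fun t => ?_
    rw [levelIncl_of]
    refine Subgroup.subset_closure ⟨_, ?_, rfl⟩
    intro heq
    have h1 := congrArg Fin.val heq
    simp only [Fin.val_castLE] at h1
    have := t.isLt
    omega
  have hz_lt : ∀ s ∈ LY, ((z s : Fin (3 + 3 * (m + (m + 1)))) : ℕ) < 3 + 3 * m := by
    intro s hs
    rw [hLY] at hs
    have := hz s
    have := s.isLt
    omega
  /- STEP (1): `y' ↦ y' · ι h` -/
  have hT1 : ∀ s ∈ LY, ∃ ρ ∈ Subgroup.closure (paddingGens (3 + 3 * (m + (m + 1)))),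
      ρ (FreeGroup.of s) = FreeGroup.of s * levelIncl m (m + 1) (h (r (z s))) ∧
        ∀ i, i ≠ s → ρ (FreeGroup.of i) = FreeGroup.of i := by
    intro s hs
    rw [hLY] at hs
    refine exists_transvection_of_mem_normalClosure (by omega) (levelIncl m (m + 1))
      (hι_avoid s hs.1) (T := FreeGroup.of '' {t : Fin (3 + 3 * m) | (t : ℕ) % 3 ≠ 0}) ?_ (hhP _)
    rintro _ ⟨t, ht, rfl⟩
    refine ⟨Fin.castLE (level_le m (m + 1)) t, levelIncl_of m (m + 1) t, ?_, ht⟩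
    intro heq
    have h1 := congrArg Fin.val heq
    simp only [Fin.val_castLE] at h1
    have := t.isLt
    omega
  obtain ⟨v₁, hv₁m, hv₁n, hv₁y⟩ := helper_freePadding_1 _ LY {i | (i : ℕ) < 3 + 3 * m}
    (fun i => levelIncl m (m + 1) (h (r (z i)))) hCO (fun s _ => hι_mem _) hT1
  /- STEP (2): old letters `x_s ↦ x_s · u₂ s` -/
  have hu₂_mem : ∀ i, u₂ i ∈ Subgroup.closure (FreeGroup.of ''
      ({i | 3 + 3 * m ≤ (i : ℕ) ∧ (i : ℕ) % 3 = 1} : Set (Fin (3 + 3 * (m + (m + 1)))))) :=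
    fun i => by rw [hu₂]; exact hlam_mem _
  have hT2 : ∀ s ∈ LO, ∃ ρ ∈ Subgroup.closure (paddingGens (3 + 3 * (m + (m + 1)))),
      ρ (FreeGroup.of s) = FreeGroup.of s * u₂ s ∧
        ∀ i, i ≠ s → ρ (FreeGroup.of i) = FreeGroup.of i := by
    intro s hs
    rw [hLO] at hs
    refine exists_transvection_of_mem_closure
      (S := {i | 3 + 3 * m ≤ (i : ℕ) ∧ (i : ℕ) % 3 = 1}) ?_ ?_ (hu₂_mem s)
    · simp only [Set.mem_setOf_eq]
      omega
    · intro t ht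
      simp only [Set.mem_setOf_eq] at ht
      omega
  obtain ⟨v₂, hv₂m, hv₂n, hv₂y⟩ := helper_freePadding_1 _ LO
    {i | 3 + 3 * m ≤ (i : ℕ) ∧ (i : ℕ) % 3 = 1} u₂ hCY (fun s _ => hu₂_mem s) hT2
  /- STEP (3): `y' ↦ y' z⁻¹` -/
  have hT3 : ∀ s ∈ LY, ∃ ρ ∈ Subgroup.closure (paddingGens (3 + 3 * (m + (m + 1)))),
      ρ (FreeGroup.of s) = FreeGroup.of s * (FreeGroup.of (z s))⁻¹ ∧
        ∀ i, i ≠ s → ρ (FreeGroup.of i) = FreeGroup.of i := by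
    intro s hs
    have hzs := hz_lt s hs
    have hzv := hz s
    rw [hLY] at hs
    refine exists_transvection_of_mem_closure
      (S := {i | (i : ℕ) < 3 + 3 * m ∧ (i : ℕ) % 3 ≠ 0}) ?_ (fun t ht => ht.2)
      (inv_mem (Subgroup.subset_closure ⟨z s, ⟨hzs, ?_⟩, rfl⟩))
    · simp only [Set.mem_setOf_eq]
      omega
    · omega
  obtain ⟨v₃, hv₃m, hv₃n, hv₃y⟩ := helper_freePadding_1 _ LY {i | (i : ℕ) < 3 + 3 * m}
    (fun i => (FreeGroup.of (z i))⁻¹) hCO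
    (fun s hs => inv_mem (Subgroup.subset_closure ⟨z s, hz_lt s hs, rfl⟩)) hT3
  /- bookkeeping: `q ∘ v₁ ∘ λ = π ∘ ι` -/
  have hφlam : ∀ w, q (v₁ (lam w)) = π (levelIncl m (m + 1) w) := by
    intro w
    have : (q.comp v₁.toMonoidHom).comp lam = π.comp (levelIncl m (m + 1)) := by
      refine FreeGroup.ext_hom _ _ fun t => ?_
      simp only [MonoidHom.comp_apply, MulEquiv.coe_toMonoidHom, levelIncl_of]
      by_cases ht : (t : ℕ) % 3 = 2
      · have hyt := hy t
        have htl := t.isLt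
        have hyL : y t ∈ LY := by rw [hLY]; omega
        have hzy : ((z (y t) : Fin (3 + 3 * (m + (m + 1)))) : ℕ) < 3 + 3 * m := by
          rw [hz, hyt]; omega
        have hrzy : r (z (y t)) = t := Fin.ext (by rw [hr _ hzy, hz, hyt]; omega)
        rw [hlam2 t ht, hv₁y _ hyL, map_mul, hqn (y t) (by omega), hπn (y t) (by omega), one_mul,
          hqι, hrzy, hhπ, levelIncl_of]
      · rw [hlamn t ht, map_one, map_one, hπn (Fin.castLE (level_le m (m + 1)) t) ht]
    exact DFunLike.congr_fun this w
  -- old letters after steps (1)–(2): `q v₁ v₂ (x_i) = π (x_i)`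
  have hold : ∀ i : Fin (3 + 3 * (m + (m + 1))), (i : ℕ) < 3 + 3 * m →
      q (v₁ (v₂ (FreeGroup.of i))) = π (FreeGroup.of i) := by
    intro i hi
    rw [hv₂y i ((hLO i).2 hi), map_mul, hv₁n i (hCO i hi), map_mul, hqo i hi, hu₂, hφlam]
    simp only [map_mul, map_inv]
    rw [mul_inv_cancel_left, levelIncl_of, hor i hi]
  -- `q ∘ v = π`, `v = v₁ v₂ v₃`, letter by letter
  have hqv : q.comp (v₁ * v₂ * v₃).toMonoidHom = π := by
    refine FreeGroup.ext_hom _ _ fun i => ?_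
    simp only [MonoidHom.comp_apply, MulEquiv.coe_toMonoidHom, MulAut.mul_apply]
    by_cases hiY : i ∈ LY
    · -- a new `y'`-letter
      have hzs := hz_lt i hiY
      have hiY' := (hLY i).1 hiY
      have hiO : i ∉ LO := hCY i hiY'
      rw [hv₃y i hiY, map_mul, map_inv, hv₂n i hiO, map_mul, map_inv, hv₁y i hiY]
      simp only [map_mul, map_inv]
      rw [hold _ hzs, hqι, hhπ, levelIncl_of, hor _ hzs, hqn i (by omega), hπn i (by omega),
        one_mul, mul_inv_cancel]
    · by_cases hiO : i ∈ LO
      · -- an old letter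
        rw [hv₃n i hiY]
        exact hold i ((hLO i).1 hiO)
      · -- a new `e'`- or `z'`-letter: untouched
        rw [hv₃n i hiY, hv₂n i hiO, hv₁n i hiY, hqn i (fun h' => hiO ((hLO i).2 h'))]
  /- the kernel of `q` is `Q'` -/
  have hqker : q.ker = Subgroup.normalClosure (levelIncl m (m + 1) ''
      ((P2 (3 + 3 * m)).map θ.toMonoidHom : Set _) ∪ newStdGens m (m + 1)) := by
    apply le_antisymm
    · intro w hw
      rw [MonoidHom.mem_ker] at hw
      -- `Θ'`: `θ` on the old letters, the identity on the new ones (as an endomorphism)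
      obtain ⟨Θ', hΘo, hΘn⟩ : ∃ Θ' : FreeGroup (Fin (3 + 3 * (m + (m + 1)))) →*
          FreeGroup (Fin (3 + 3 * (m + (m + 1)))),
          (∀ i : Fin (3 + 3 * (m + (m + 1))), (i : ℕ) < 3 + 3 * m →
            Θ' (FreeGroup.of i) = levelIncl m (m + 1) (θ (FreeGroup.of (r i)))) ∧
          (∀ i : Fin (3 + 3 * (m + (m + 1))), ¬ (i : ℕ) < 3 + 3 * m →
            Θ' (FreeGroup.of i) = FreeGroup.of i) :=
        ⟨FreeGroup.lift fun i => if (i : ℕ) < 3 + 3 * m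
            then levelIncl m (m + 1) (θ (FreeGroup.of (r i))) else FreeGroup.of i,
          fun i hi => by rw [FreeGroup.lift_apply_of, if_pos hi],
          fun i hi => by rw [FreeGroup.lift_apply_of, if_neg hi]⟩
      have hΘι : ∀ x, Θ' (levelIncl m (m + 1) x) = levelIncl m (m + 1) (θ x) := by
        intro x
        have : Θ'.comp (levelIncl m (m + 1)) = (levelIncl m (m + 1)).comp θ.toMonoidHom :=
          FreeGroup.ext_hom _ _ fun t => by
            simp only [MonoidHom.comp_apply, MulEquiv.coe_toMonoidHom, levelIncl_of]
            rw [hΘo (Fin.castLE (level_le m (m + 1)) t) t.2, hro]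
        exact DFunLike.congr_fun this x
      -- generators of `Q'`
      have hQold : ∀ t : Fin (3 + 3 * m), (t : ℕ) % 3 ≠ 2 →
          levelIncl m (m + 1) (θ (FreeGroup.of t)) ∈ Subgroup.normalClosure (levelIncl m (m + 1) ''
            ((P2 (3 + 3 * m)).map θ.toMonoidHom : Set _) ∪ newStdGens m (m + 1)) :=
        fun t ht => Subgroup.subset_normalClosure (Or.inl ⟨θ (FreeGroup.of t),
          Subgroup.mem_map_of_mem _ (Subgroup.subset_normalClosure ⟨t, ht, rfl⟩), rfl⟩)
      have hQnew : ∀ i : Fin (3 + 3 * (m + (m + 1))), 3 + 3 * m ≤ (i : ℕ) → (i : ℕ) % 3 ≠ 2 →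
          FreeGroup.of i ∈ Subgroup.normalClosure (levelIncl m (m + 1) ''
            ((P2 (3 + 3 * m)).map θ.toMonoidHom : Set _) ∪ newStdGens m (m + 1)) :=
        fun i h1 h2 => Subgroup.subset_normalClosure (Or.inr ⟨i, ⟨h1, h2⟩, rfl⟩)
      -- `ψ : F(z, z') → F'/Q'`, `z ↦ Θ' z`
      obtain ⟨ψ, hψ⟩ : ∃ ψ : FreeGroup {i : Fin (3 + 3 * (m + (m + 1))) // (i : ℕ) % 3 = 2} →*
          FreeGroup (Fin (3 + 3 * (m + (m + 1)))) ⧸ Subgroup.normalClosure (levelIncl m (m + 1) ''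
            ((P2 (3 + 3 * m)).map θ.toMonoidHom : Set _) ∪ newStdGens m (m + 1)),
          ∀ j, ψ (FreeGroup.of j) = QuotientGroup.mk (Θ' (FreeGroup.of j.1)) :=
        ⟨FreeGroup.lift fun j => QuotientGroup.mk (Θ' (FreeGroup.of j.1)), fun j => by
          rw [FreeGroup.lift_apply_of]⟩
      have hψπι : ∀ x, ψ (π (levelIncl m (m + 1) x)) =
          QuotientGroup.mk (Θ' (levelIncl m (m + 1) x)) := by
        intro x
        have : (ψ.comp π).comp (levelIncl m (m + 1)) =
            (QuotientGroup.mk' _).comp (Θ'.comp (levelIncl m (m + 1))) :=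
          FreeGroup.ext_hom _ _ fun t => by
            simp only [MonoidHom.comp_apply, QuotientGroup.mk'_apply, levelIncl_of]
            by_cases ht : (t : ℕ) % 3 = 2
            · rw [hπ2 (Fin.castLE (level_le m (m + 1)) t) ht, hψ]
            · rw [hπn (Fin.castLE (level_le m (m + 1)) t) ht, map_one,
                hΘo (Fin.castLE (level_le m (m + 1)) t) t.2, hro, eq_comm, QuotientGroup.eq_one_iff]
              exact hQold t ht
        exact DFunLike.congr_fun this x
      have hψq : ψ.comp q = QuotientGroup.mk' _ := by
        refine FreeGroup.ext_hom _ _ fun i => ?_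
        simp only [MonoidHom.comp_apply, QuotientGroup.mk'_apply]
        by_cases hi : (i : ℕ) < 3 + 3 * m
        · have hoi : FreeGroup.of i = levelIncl m (m + 1) (FreeGroup.of (r i)) := by
            rw [levelIncl_of, hor i hi]
          rw [hoi, hqι, hψπι, hΘι, MulAut.apply_inv_self]
        · rw [hqn i hi]
          by_cases h2 : (i : ℕ) % 3 = 2
          · rw [hπ2 i h2, hψ, hΘn _ hi]
          · rw [hπn i h2, map_one, eq_comm, QuotientGroup.eq_one_iff]
            exact hQnew i (by omega) h2
      have := DFunLike.congr_fun hψq w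
      rw [MonoidHom.comp_apply, hw, map_one, QuotientGroup.mk'_apply, eq_comm,
        QuotientGroup.eq_one_iff] at this
      exact this
    · refine Subgroup.normalClosure_le_normal ?_
      rintro _ (⟨x, hx, rfl⟩ | ⟨i, hi, rfl⟩)
      · obtain ⟨b, hb, rfl⟩ := Subgroup.mem_map.1 hx
        rw [SetLike.mem_coe, MonoidHom.mem_ker, hqι, MulEquiv.coe_toMonoidHom,
          MulAut.inv_apply_self]
        exact hπι b hb
      · have hi1 := hi.1
        rw [SetLike.mem_coe, MonoidHom.mem_ker, hqn i (by omega), hπn i hi.2]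
  /- conclusion: `v⁻¹(Q') = ker (q ∘ v) = ker π = P₂'`, so `v(P₂') = Q'` -/
  refine ⟨v₁ * v₂ * v₃, mul_mem (mul_mem hv₁m hv₂m) hv₃m, ?_⟩
  have hker : P2 (3 + 3 * (m + (m + 1))) = q.ker.comap (v₁ * v₂ * v₃).toMonoidHom := by
    rw [MonoidHom.comap_ker, hqv, hπker]
  rw [hker, Subgroup.map_comap_eq_self_of_surjective (v₁ * v₂ * v₃).surjective, hqker]

end Summit.SmoothPoincare4.SmoothPoincare4.Theorems.NormalFormStablyTrivial.Luft

end
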